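import Mathlib.Geometry.Manifold.Instances.Sphere
import Mathlib.Geometry.Manifold.Diffeomorph
import Mathlib.Analysis.SpecialFunctions.Gaussian.GaussianIntegral
import Literature.Geometry.Lorentzian.LeviCivita
import Literature.Geometry.Lorentzian.Volume
import HarnessLib

/-!
# Cheeger–Colding's differentiable volume sphere theorem (named fact)

Topic `Literature/Geometry/Riemannian`; cite item `wi-15228` for route SmoothPoincare4/RicciFat
(crux `VolumeSphereRecognition` = item stmt-SmoothPoincare4-5191, whose Lean text is reproduced
verbatim by `CheegerColding1997_thmA110.dim_four` below).

Cheeger–Colding 1997, Appendix 1, Theorem A.1.10 (J. Differential Geom. 46 (1997) 406–480,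
p. 459), verbatim: "There exists `δ(n) > 0`, such that if `Ric_{Mⁿ} ≥ n - 1`,
`Vol(Mⁿ) ≥ (1 - δ(n)) Vol(Sⁿ)`, then `Mⁿ` is diffeomorphic to `Sⁿ`." (Announced in the
introduction, p. 412: "there exists `δ(n) > 0`, such that if `Ric_{Mⁿ} ≥ n - 1` and
`Vol(Mⁿ) ≥ (1 - δ(n)) Vol(S₁ⁿ)`, then `Mⁿ` is diffeomorphic to the sphere, `Sⁿ`. Indeed `Mⁿ`
might be bi-Lipschitz to `Sⁿ`, but this does not follow from Reifenberg's method.") Standing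
conventions of the paper (p. 406): `Mⁿ` ranges over complete, connected Riemannian
`n`-manifolds; `Sⁿ = S₁ⁿ` is the unit round sphere. The proof (p. 459: "by arguing as in [24],
[25] … but letting Theorem A.1.8 play the role of Perelman's theorem") combines the intrinsic
Reifenberg theorem A.1.1–A.1.3 / A.1.8–A.1.9 with Colding's volume convergence [26] and the
Cheeger–Colding almost-rigidity results [24], [25]; the homeomorphism version is Perelman 1994.
The constant `δ(n)` is ineffective.

* `unitSphereVolume n = 2 π^{(n+1)/2} / Γ((n+1)/2)` — the `n`-dimensional volume of the unit
  round sphere `Sⁿ ⊂ ℝⁿ⁺¹` (`= (n+1) · Vol(B₁ⁿ⁺¹)`), a real number; `unitSphereVolume_four :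
  unitSphereVolume 4 = 8π²/3` PROVED (`Γ(5/2) = ¾√π`).
* NAMED FACT `CheegerColding1997_thmA110` — for every `n ≥ 2` there is `δ > 0` such that every
  COMPACT CONNECTED smooth (`C^∞`, Hausdorff, second countable, modelled on `ℝⁿ`) manifold `M`
  with a `C^∞` Riemannian metric `h` on `TM` (Mathlib's `Bundle.ContMDiffRiemannianMetric`; the
  tree's Levi-Civita/Ricci API of `LeviCivita.lean` through `PseudoRiemannianMetric.ofRiemannian`,
  under its standing instance `[HasLeviCivita]`) satisfying `Ric_h ≥ (n-1) h` pointwise and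
  `Vol(M, h) ≥ (1 - δ) |Sⁿ|` is `C^∞`-diffeomorphic to the unit sphere
  `Sⁿ ⊂ EuclideanSpace ℝ (Fin (n+1))` with Mathlib's manifold structure. Here `Vol(M, h)` is the
  tree's `riemannianMeasure h univ` (`Volume.lean`: the Euclidean-normalised `n`-dimensional
  Hausdorff measure of the length metric of `h`, which is the Riemannian volume, Federer 1969
  §3.2.46) and `|Sⁿ| = unitSphereVolume n`.
* `CheegerColding1997_thmA110.dim_four` — the case `n = 4`, PROVED from the fact, stated
  literally as the route decl `VolumeSphereRecognition` (`Ric ≥ 3h`, `Vol ≥ (1-δ)·8π²/3`,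
  `S⁴ ⊂ EuclideanSpace ℝ (Fin 5)`).

## Faithfulness and scope

* HYPOTHESES ONLY SPECIALISED, NEVER WEAKENED: the printed theorem is for complete connected
  manifolds; compact ⇒ complete, so the compact connected case asserted here is an instance
  (and by Myers' theorem `Ric ≥ n-1 > 0` forces compactness anyway). Connectedness is essential
  (two round spheres have `Ric = n-1` and twice the volume) and is an explicit binder.
* `n ≥ 2` is imposed: the paper's `n` is the dimension of Riemannian manifolds with a Ricci
  bound `-(n-1)`/`n-1`, and nothing is claimed (or needed) for curves.
* `Vol(Sⁿ)` enters as the classical closed formula `2π^{(n+1)/2}/Γ((n+1)/2)` rather than as the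
  measure of a round sphere object (the tree's `roundMetric` is a `PseudoRiemannianMetric`, not a
  `ContMDiffRiemannianMetric`, so `riemannianMeasure` does not apply to it verbatim); the
  identification is the standard surface-area formula [folklore].
* The regularity asked of `h` is `C^∞` ("smooth Riemannian manifold", p. 459, Thm A.1.9/A.1.12).
* Deep theorem (Gromov–Hausdorff limits, volume convergence, Reifenberg): no `_holds`; users take
  `(h : CheegerColding1997_thmA110)` and, in dimension four, `h.dim_four`.

## References

* J. Cheeger, T. H. Colding, *On the structure of spaces with Ricci curvature bounded below. I*,
  J. Differential Geom. 46 (1997) 406–480, Appendix 1, Thm A.1.10 (p. 459), also p. 412 and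
  Thms A.1.8–A.1.12. Read: `lit read doi:10.4310/jdg/1214459974`, pp. 406–407, 412, 458–459.
  [CheegerColding1997]
* G. Perelman, *Manifolds of positive Ricci curvature with almost maximal volume*, J. Amer.
  Math. Soc. 7 (1994) 299–305 (homeomorphism version). [Perelman1994]
* T. H. Colding, *Ricci curvature and volume convergence*, Ann. of Math. 145 (1997) 477–501
  (the paper's [26]). [Colding1997]
* J. Cheeger, T. H. Colding, *Lower bounds on Ricci curvature and the almost rigidity of warped
  products*, Ann. of Math. 144 (1996) 189–237 (the paper's [24]–[25]). [CheegerColding1996]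
* H. Federer, *Geometric Measure Theory* (1969), §3.2.46 (Hausdorff measure = Riemannian volume).
-/

noncomputable section

open scoped Manifold ContDiff ENNReal

namespace Literature.Geometry.Riemannian

open Literature.Geometry.Lorentzian (PseudoRiemannianMetric riemannianMeasure)

/-- The `n`-dimensional volume of the unit round sphere `Sⁿ ⊂ ℝⁿ⁺¹`:
`|Sⁿ| = 2 π^{(n+1)/2} / Γ((n+1)/2)` (`= (n+1)·ω_{n+1}`, `ω_m = π^{m/2}/Γ(m/2+1)` the volume of
the unit `m`-ball; `|S¹| = 2π`, `|S²| = 4π`, `|S³| = 2π²`, `|S⁴| = 8π²/3`). [folklore] -/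
def unitSphereVolume (n : ℕ) : ℝ :=
  2 * Real.pi ^ (((n : ℝ) + 1) / 2) / Real.Gamma (((n : ℝ) + 1) / 2)

/-- `|S⁴| = 8π²/3` (`Γ(5/2) = ¾√π`, `π^{5/2} = π²√π`). [folklore] -/
theorem unitSphereVolume_four : unitSphereVolume 4 = 8 * Real.pi ^ 2 / 3 := by
  have hΓ : Real.Gamma ((((4 : ℕ) : ℝ) + 1) / 2) = 3 / 4 * Real.sqrt Real.pi := by
    have h1 : (((4 : ℕ) : ℝ) + 1) / 2 = 3 / 2 + 1 := by norm_num
    rw [h1, Real.Gamma_add_one (by norm_num : (3 / 2 : ℝ) ≠ 0)]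
    have h2 : (3 / 2 : ℝ) = 1 / 2 + 1 := by norm_num
    rw [h2, Real.Gamma_add_one (by norm_num : (1 / 2 : ℝ) ≠ 0), Real.Gamma_one_half_eq]
    ring
  have hπ : Real.pi ^ ((((4 : ℕ) : ℝ) + 1) / 2) = Real.pi ^ 2 * Real.sqrt Real.pi := by
    have h1 : (((4 : ℕ) : ℝ) + 1) / 2 = (2 : ℝ) + 1 / 2 := by norm_num
    rw [h1, Real.rpow_add Real.pi_pos, Real.rpow_two, Real.sqrt_eq_rpow]
  unfold unitSphereVolume
  rw [hΓ, hπ]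
  have hs : Real.sqrt Real.pi ≠ 0 := (Real.sqrt_pos.2 Real.pi_pos).ne'
  field_simp
  ring

/-- **Cheeger–Colding 1997, Theorem A.1.10 (differentiable volume sphere theorem; NAMED FACT,
not proved here).** Printed (p. 459): "There exists `δ(n) > 0`, such that if `Ric_{Mⁿ} ≥ n - 1`,
`Vol(Mⁿ) ≥ (1 - δ(n)) Vol(Sⁿ)`, then `Mⁿ` is diffeomorphic to `Sⁿ`", `Mⁿ` a complete connected
Riemannian `n`-manifold (p. 406), `Sⁿ` the unit round sphere. VENDORED INSTANCE (compact ⇒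
complete): for every `n ≥ 2` there is `δ > 0` such that for every compact, connected,
Hausdorff, second countable `C^∞` manifold `M` modelled on `ℝⁿ` and every `C^∞` Riemannian
metric `h` on `TM` (with the tree's Levi-Civita connection, `[(ofRiemannian h).HasLeviCivita]`),
if `Ric_h(v, v) ≥ (n - 1) h(v, v)` for all tangent vectors `v` and
`riemannianMeasure h univ ≥ (1 - δ) · |Sⁿ|` (`|Sⁿ| = unitSphereVolume n = 2π^{(n+1)/2}/Γ((n+1)/2)`;
`riemannianMeasure` = Euclidean-normalised Hausdorff `n`-measure of the length metric = the
Riemannian volume), then `M` is `C^∞`-diffeomorphic to the unit sphere `Sⁿ ⊂ ℝⁿ⁺¹`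
(`Metric.sphere (0 : EuclideanSpace ℝ (Fin (n+1))) 1` with Mathlib's `𝓡 n`-manifold structure).
`δ` depends on `n` only and is ineffective. Homeomorphism version: Perelman 1994; inputs:
Colding 1997 (volume convergence), Cheeger–Colding 1996, intrinsic Reifenberg (Thm A.1.1 ff.).
[cite: CheegerColding1997, Appendix 1 Thm A.1.10 (p. 459)] -/
def CheegerColding1997_thmA110 : Prop :=
  ∀ n : ℕ, 2 ≤ n → ∃ δ : ℝ, 0 < δ ∧
    ∀ (M : Type) [TopologicalSpace M] [T2Space M] [SecondCountableTopology M]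
      [ChartedSpace (EuclideanSpace ℝ (Fin n)) M] [IsManifold (𝓡 n) ∞ M] [CompactSpace M]
      [ConnectedSpace M] [MeasurableSpace M] [BorelSpace M]
      (h : Bundle.ContMDiffRiemannianMetric (𝓡 n) ∞ (EuclideanSpace ℝ (Fin n))
        (TangentSpace (𝓡 n) : M → Type _))
      [(PseudoRiemannianMetric.ofRiemannian h).HasLeviCivita],
      (∀ (x : M) (v : TangentSpace (𝓡 n) x),
          ((n : ℝ) - 1) * h.inner x v v ≤ (PseudoRiemannianMetric.ofRiemannian h).ricci x v v) →
        ENNReal.ofReal ((1 - δ) * unitSphereVolume n) ≤ riemannianMeasure h Set.univ →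
          Nonempty (M ≃ₘ⟮𝓡 n, 𝓡 n⟯ Metric.sphere (0 : EuclideanSpace ℝ (Fin (n + 1))) 1)

/-- **Theorem A.1.10 in dimension four** — literally the statement `VolumeSphereRecognition` of
route SmoothPoincare4/RicciFat, derived from the named fact at `n = 4` (`(4:ℝ) - 1 = 3`,
`|S⁴| = 8π²/3` by `unitSphereVolume_four`): there is `δ > 0` such that every compact connected
smooth `4`-manifold with a `C^∞` Riemannian metric `h`, `Ric_h ≥ 3h` and
`Vol(M, h) ≥ (1 - δ)·8π²/3` is diffeomorphic to `S⁴ ⊂ ℝ⁵`.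
[cite: CheegerColding1997, Appendix 1 Thm A.1.10 (p. 459)] -/
theorem CheegerColding1997_thmA110.dim_four (hCC : CheegerColding1997_thmA110) :
    ∃ δ : ℝ, 0 < δ ∧ ∀ (M : Type) [TopologicalSpace M] [T2Space M] [SecondCountableTopology M]
      [ChartedSpace (EuclideanSpace ℝ (Fin 4)) M] [IsManifold (𝓡 4) ∞ M] [CompactSpace M]
      [ConnectedSpace M] [MeasurableSpace M] [BorelSpace M]
      (h : Bundle.ContMDiffRiemannianMetric (𝓡 4) ∞ (EuclideanSpace ℝ (Fin 4))
        (TangentSpace (𝓡 4) : M → Type _))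
      [(Literature.Geometry.Lorentzian.PseudoRiemannianMetric.ofRiemannian h).HasLeviCivita],
      (∀ (x : M) (v : TangentSpace (𝓡 4) x), 3 * h.inner x v v ≤
          (Literature.Geometry.Lorentzian.PseudoRiemannianMetric.ofRiemannian h).ricci x v v) →
        ENNReal.ofReal ((1 - δ) * (8 * Real.pi ^ 2 / 3)) ≤
            Literature.Geometry.Lorentzian.riemannianMeasure h Set.univ →
          Nonempty (M ≃ₘ⟮𝓡 4, 𝓡 4⟯ Metric.sphere (0 : EuclideanSpace ℝ (Fin 5)) 1) := by
  obtain ⟨δ, hδ, H⟩ := hCC 4 (by norm_num)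
  refine ⟨δ, hδ, ?_⟩
  intro M _ _ _ _ _ _ _ _ _ h _ hRic hVol
  have hRic' : ∀ (x : M) (v : TangentSpace (𝓡 4) x),
      (((4 : ℕ) : ℝ) - 1) * h.inner x v v ≤ (PseudoRiemannianMetric.ofRiemannian h).ricci x v v := by
    intro x v
    have h3 : (((4 : ℕ) : ℝ) - 1) = 3 := by norm_num
    rw [h3]
    exact hRic x v
  have hVol' : ENNReal.ofReal ((1 - δ) * unitSphereVolume 4) ≤ riemannianMeasure h Set.univ := by
    rw [unitSphereVolume_four]
    exact hVol
  exact H M h hRic' hVol'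

end Literature.Geometry.Riemannian
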